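import Mathlib
import HarnessLib
import Literature.NumberTheory.Automorphic.WeightOneDescent
import Literature.NumberTheory.Automorphic.HyperbolicDirichletForm
import Summits.Langlands.Langlands.Theorems.QuarterDeficit1951CorrespondentFingerprintStubDescentAux2

/-!
# Crux `CorrespondentFingerprint` (stmt-Langlands-15898), line `Sketch`, stub `stub_descent`:
# auxiliary file 3 — the Casimir operator on weight-`0` vectors is twice the hyperbolic Laplacian

For `φ` archimedean-smooth of `SO(2)`-weight `0` and killed by `Z`, the Casimir operator
`Ω = ½ h² + E₁₂E₂₁ + E₂₁E₁₂` of `GL2WeightVectors` acts as `2(E₁₁² + E₁₂² - E₁₁)`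
(`casimirFun_eq_of_isWeightVec_zero`, from the bracket relations `[W, E₁₂] = h`, `[Z, h] = 0` and
`W φ = Z φ = 0`); on the section `g_τ = (y x; 0 1)` one has `E₁₂ = y ∂ₓ`, `E₁₁ = y ∂_y`
(`hasFDerivAt_comp_upperHalfPlaneToGL`), so `E₁₁² + E₁₂² - E₁₁ = y²(∂ₓ² + ∂_y²)` is Iwaniec's
`Δ` (`hypLaplacian_comp_upperHalfPlaneToGL_eq`), and `Ω φ₀ = c φ₀` descends to
`Δ u + (-c/2) u = 0` (registered sub-goal `stub_descent_eigen`).  Theorems only; no `sorry`.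
-/

set_option linter.dupNamespace false

noncomputable section

open scoped MatrixGroups Matrix NumberField ContDiff Topology Classical
open Literature.NumberTheory.Automorphic Literature.NumberTheory.GaloisRepresentations
  IsDedekindDomain NumberField
open Literature.NumberTheory.Automorphic.GL2Real
open Filter UpperHalfPlane

namespace Summit.Langlands.Langlands.Theorems.CorrespondentFingerprint

/-! ### `Ω = 2(E₁₁² + E₁₂² - E₁₁)` on weight-`0`, `Z`-killed functions -/

section Algebra

variable {G : Type*} [Group G] {ι : (RealMatrixGroup.gl ℝ (Fin 2)).carrier →* G}

/-- `[W, E₁₂] = h` in `𝔤𝔩₂(ℝ)` (`W = E₁₂ - E₂₁`, `h = E₁₁ - E₂₂`). [folklore] -/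
theorem lie_rotGen_e₁₂ : ⁅toLie rotGen, toLie e₁₂⁆ = toLie hMat := by
  refine Subtype.ext ?_
  change rotGen * e₁₂ - e₁₂ * rotGen = hMat
  rw [rotGen, hMat, e₁₁, e₂₂, e₁₂]
  ext i j
  fin_cases i <;> fin_cases j <;> norm_num

/-- `[Z, h] = 0` in `𝔤𝔩₂(ℝ)`. [folklore] -/
theorem lie_one_hMat : ⁅toLie (1 : Matrix (Fin 2) (Fin 2) ℝ), toLie hMat⁆ = 0 := by
  refine Subtype.ext ?_
  change (1 : Matrix (Fin 2) (Fin 2) ℝ) * hMat - hMat * 1 = 0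
  rw [Matrix.one_mul, Matrix.mul_one, sub_self]

/-- `h = 2 E₁₁ - Z` in `𝔤𝔩₂(ℝ)`. [folklore] -/
theorem toLie_hMat_eq : toLie hMat = (2 : ℝ) • toLie e₁₁ - toLie (1 : Matrix (Fin 2) (Fin 2) ℝ) := by
  refine Subtype.ext ?_
  change hMat = (2 : ℝ) • e₁₁ - (1 : Matrix (Fin 2) (Fin 2) ℝ)
  rw [hMat, one_eq_e₁₁_add_e₂₂, e₁₁, e₂₂]
  ext i j
  fin_cases i <;> fin_cases j <;> norm_num

/-- **On weight-`0`, `Z`-killed functions `h φ = 2 E₁₁ φ`.** [cite: Bump1997, §2.2] -/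
theorem lieDeriv_hMat_of_weight_zero {φ : G → ℂ} (hφ : IsArchSmooth ι φ) (hZ : lieDeriv ι (toLie 1) φ = 0) :
    lieDeriv ι (toLie hMat) φ = (2 : ℂ) • lieDeriv ι (toLie e₁₁) φ := by
  rw [toLie_hMat_eq, sub_eq_add_neg, ← neg_one_smul ℝ (toLie (1 : Matrix (Fin 2) (Fin 2) ℝ)),
    lieDeriv_smul_add_smul_of_isArchSmooth hφ, hZ, smul_zero, add_zero]
  funext x
  simp only [Pi.smul_apply, Complex.real_smul, smul_eq_mul]
  push_cast
  ring

/-- **`Ω φ = 2 (E₁₁(E₁₁ φ) + E₁₂(E₁₂ φ) - E₁₁ φ)` for `φ` archimedean-smooth of `SO(2)`-weight `0`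
killed by `Z`** (`E₂₁ φ = E₁₂ φ` as `W φ = 0`; `E₂₁(E₁₂φ) = E₁₂(E₁₂φ) - W(E₁₂φ)` and
`W(E₁₂ φ) = E₁₂(W φ) + [W, E₁₂] φ = h φ = 2 E₁₁ φ`; `h(h φ) = 2 E₁₁(h φ) - Z(h φ)` and
`Z(h φ) = h(Z φ) + [Z, h] φ = 0`). Bump 1997, §2.2 (`-4Δ = H² + 2RL + 2LR` on weight `0`).
[cite: Bump1997, §2.2 (Prop. 2.2.5)] -/
theorem casimirFun_eq_of_isWeightVec_zero {φ : G → ℂ} (hφ : IsArchSmooth ι φ) (hw : IsWeightVec ι 0 φ)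
    (hZ : lieDeriv ι (toLie 1) φ = 0) :
    casimirFun ι φ = (2 : ℂ) • (lieDeriv ι (toLie e₁₁) (lieDeriv ι (toLie e₁₁) φ) +
      lieDeriv ι (toLie e₁₂) (lieDeriv ι (toLie e₁₂) φ) - lieDeriv ι (toLie e₁₁) φ) := by
  -- smoothness of first derivatives
  have he₁₁ := isArchSmooth_lieDeriv_toLie hφ e₁₁
  have he₁₂ := isArchSmooth_lieDeriv_toLie hφ e₁₂
  have hh := isArchSmooth_lieDeriv_toLie hφ hMat
  -- `W φ = 0`
  have hW : lieDeriv ι (toLie rotGen) φ = 0 := by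
    rw [hw.lieDeriv_rotGen]; simp
  -- `E₂₁ φ = E₁₂ φ`
  have h21 : lieDeriv ι (toLie e₂₁) φ = lieDeriv ι (toLie e₁₂) φ := by
    have h := lieDeriv_rotGen_eq_sub hφ
    rw [hW] at h
    exact (sub_eq_zero.1 h.symm).symm
  -- `h φ = 2 E₁₁ φ`
  have hh2 := lieDeriv_hMat_of_weight_zero hφ hZ
  -- `W (E₁₂ φ) = h φ`
  have hWe : lieDeriv ι (toLie rotGen) (lieDeriv ι (toLie e₁₂) φ) = lieDeriv ι (toLie hMat) φ := by
    have h := lieDeriv_bracket_of_top ι gl2_lie_eq_top gl2_carrier_eq_top (toLie rotGen) (toLie e₁₂) hφ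
    rw [lie_rotGen_e₁₂, hW, lieDeriv_zero_right, sub_zero] at h
    exact h.symm
  -- `E₂₁ (E₁₂ φ) = E₁₂ (E₁₂ φ) - h φ`
  have h2112 : lieDeriv ι (toLie e₂₁) (lieDeriv ι (toLie e₁₂) φ) =
      lieDeriv ι (toLie e₁₂) (lieDeriv ι (toLie e₁₂) φ) - lieDeriv ι (toLie hMat) φ := by
    have h := lieDeriv_rotGen_eq_sub he₁₂
    rw [hWe] at h
    rw [h]; abel
  -- `Z (h φ) = 0`
  have hZh : lieDeriv ι (toLie 1) (lieDeriv ι (toLie hMat) φ) = 0 := by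
    have h := lieDeriv_bracket_of_top ι gl2_lie_eq_top gl2_carrier_eq_top (toLie (1 : Matrix (Fin 2) (Fin 2) ℝ))
      (toLie hMat) hφ
    rw [lie_one_hMat, lieDeriv_zero_left, hZ, lieDeriv_zero_right, sub_zero] at h
    exact h.symm
  -- `h (h φ) = 4 E₁₁ (E₁₁ φ)`
  have hhh : lieDeriv ι (toLie hMat) (lieDeriv ι (toLie hMat) φ) =
      (4 : ℂ) • lieDeriv ι (toLie e₁₁) (lieDeriv ι (toLie e₁₁) φ) := by
    rw [lieDeriv_hMat_of_weight_zero hh hZh, hh2, lieDeriv_smul, smul_smul]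
    norm_num
  unfold casimirFun
  rw [hhh, h21, h2112, hh2]
  funext x
  simp only [Pi.add_apply, Pi.sub_apply, Pi.smul_apply, smul_eq_mul]
  ring

end Algebra

/-! ### `E₁₁² + E₁₂² - E₁₁ = y²(∂ₓ² + ∂_y²)` on the section `g_τ` -/

section Analysis

variable {F : GL (Fin 2) ℝ → ℂ}

/-- The real differential of `z ↦ F(g_z)` at a point of `ℍ` (`hasFDerivAt_comp_upperHalfPlaneToGL`).
[cite: Bump1997, Prop. 2.2.5 (proof)] -/
theorem fderiv_comp_upperHalfPlaneToGL (hs : IsArchSmooth incl F) (τ : ℍ) :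
    fderiv ℝ (fun z : ℂ => F (upperHalfPlaneToGL (ofComplex z))) (τ : ℂ) =
      (τ.im)⁻¹ • ((Complex.imCLM).smulRight (lieDeriv incl (toLie e₁₁) F (upperHalfPlaneToGL τ)) +
        (Complex.reCLM).smulRight (lieDeriv incl (toLie e₁₂) F (upperHalfPlaneToGL τ))) :=
  (hasFDerivAt_comp_upperHalfPlaneToGL hs τ).fderiv

/-- **`∂ₓ F(g_τ) = y⁻¹ (E₁₂ F)(g_τ)`.** [cite: Bump1997, Prop. 2.2.5 (proof)] -/
theorem fderiv_comp_upperHalfPlaneToGL_one (hs : IsArchSmooth incl F) (τ : ℍ) :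
    fderiv ℝ (fun z : ℂ => F (upperHalfPlaneToGL (ofComplex z))) (τ : ℂ) 1 =
      (τ.im)⁻¹ • lieDeriv incl (toLie e₁₂) F (upperHalfPlaneToGL τ) := by
  rw [fderiv_comp_upperHalfPlaneToGL hs τ]
  simp only [FunLike.coe_smul, FunLike.coe_add, Pi.smul_apply, Pi.add_apply,
    ContinuousLinearMap.smulRight_apply,
    Complex.imCLM_apply, Complex.reCLM_apply, Complex.one_im, Complex.one_re, zero_smul, one_smul, zero_add]

/-- **`∂_y F(g_τ) = y⁻¹ (E₁₁ F)(g_τ)`.** [cite: Bump1997, Prop. 2.2.5 (proof)] -/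
theorem fderiv_comp_upperHalfPlaneToGL_I (hs : IsArchSmooth incl F) (τ : ℍ) :
    fderiv ℝ (fun z : ℂ => F (upperHalfPlaneToGL (ofComplex z))) (τ : ℂ) Complex.I =
      (τ.im)⁻¹ • lieDeriv incl (toLie e₁₁) F (upperHalfPlaneToGL τ) := by
  rw [fderiv_comp_upperHalfPlaneToGL hs τ]
  simp only [FunLike.coe_smul, FunLike.coe_add, Pi.smul_apply, Pi.add_apply,
    ContinuousLinearMap.smulRight_apply,
    Complex.imCLM_apply, Complex.reCLM_apply, Complex.I_im, Complex.I_re, zero_smul, one_smul, add_zero]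

/-- The real differential of `w ↦ (im w)⁻¹` on the upper half plane. [folklore] -/
theorem hasFDerivAt_im_inv (τ : ℍ) :
    HasFDerivAt (fun w : ℂ => (w.im)⁻¹) ((-(τ.im ^ 2)⁻¹) • Complex.imCLM) (τ : ℂ) := by
  have h := (hasDerivAt_inv τ.im_ne_zero).comp_hasFDerivAt (τ : ℂ) Complex.imCLM.hasFDerivAt
  exact h

/-- The real differential of `w ↦ (im w)⁻¹ · G(g_w)` for `G` archimedean-smooth. [folklore] -/
theorem hasFDerivAt_im_inv_smul_comp (hs : IsArchSmooth incl F) (τ : ℍ) :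
    HasFDerivAt (fun w : ℂ => (w.im)⁻¹ • F (upperHalfPlaneToGL (ofComplex w)))
      ((τ.im)⁻¹ • ((τ.im)⁻¹ • ((Complex.imCLM).smulRight (lieDeriv incl (toLie e₁₁) F (upperHalfPlaneToGL τ)) +
          (Complex.reCLM).smulRight (lieDeriv incl (toLie e₁₂) F (upperHalfPlaneToGL τ)))) +
        ((-(τ.im ^ 2)⁻¹) • Complex.imCLM).smulRight (F (upperHalfPlaneToGL τ))) (τ : ℂ) := by
  have h := (hasFDerivAt_im_inv τ).smul (hasFDerivAt_comp_upperHalfPlaneToGL hs τ)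
  rw [ofComplex_apply] at h
  exact h

/-- **`∂ₓ∂ₓ F(g_τ) = y⁻² (E₁₂ E₁₂ F)(g_τ)`.** [cite: Bump1997, §2.2] -/
theorem fderiv_fderiv_comp_upperHalfPlaneToGL_one (hs : IsArchSmooth incl F) (τ : ℍ) :
    fderiv ℝ (fun w : ℂ => fderiv ℝ (fun z : ℂ => F (upperHalfPlaneToGL (ofComplex z))) w 1) (τ : ℂ) 1 =
      ((τ.im)⁻¹ * (τ.im)⁻¹) • lieDeriv incl (toLie e₁₂) (lieDeriv incl (toLie e₁₂) F) (upperHalfPlaneToGL τ) := by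
  have hA : IsArchSmooth incl (lieDeriv incl (toLie e₁₂) F) := isArchSmooth_lieDeriv_toLie hs e₁₂
  have heq : (fun w : ℂ => fderiv ℝ (fun z : ℂ => F (upperHalfPlaneToGL (ofComplex z))) w 1) =ᶠ[𝓝 (τ : ℂ)]
      fun w : ℂ => (w.im)⁻¹ • lieDeriv incl (toLie e₁₂) F (upperHalfPlaneToGL (ofComplex w)) := by
    filter_upwards [isOpen_upperHalfPlaneSet.mem_nhds τ.im_pos] with w hw
    have h := fderiv_comp_upperHalfPlaneToGL_one hs ⟨w, hw⟩
    rw [ofComplex_apply_of_im_pos hw]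
    exact h
  rw [heq.fderiv_eq, (hasFDerivAt_im_inv_smul_comp hA τ).fderiv]
  simp only [FunLike.coe_smul, FunLike.coe_add, Pi.smul_apply, Pi.add_apply,
    ContinuousLinearMap.smulRight_apply,
    Complex.imCLM_apply, Complex.reCLM_apply, Complex.one_im, Complex.one_re, zero_smul, one_smul, zero_add,
    smul_zero, add_zero, smul_smul]

/-- **`∂_y∂_y F(g_τ) = y⁻² ((E₁₁ E₁₁ F)(g_τ) - (E₁₁ F)(g_τ))`.** [cite: Bump1997, §2.2] -/
theorem fderiv_fderiv_comp_upperHalfPlaneToGL_I (hs : IsArchSmooth incl F) (τ : ℍ) :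
    fderiv ℝ (fun w : ℂ => fderiv ℝ (fun z : ℂ => F (upperHalfPlaneToGL (ofComplex z))) w Complex.I) (τ : ℂ) Complex.I =
      ((τ.im)⁻¹ * (τ.im)⁻¹) • lieDeriv incl (toLie e₁₁) (lieDeriv incl (toLie e₁₁) F) (upperHalfPlaneToGL τ) +
        (-(τ.im ^ 2)⁻¹) • lieDeriv incl (toLie e₁₁) F (upperHalfPlaneToGL τ) := by
  have hB : IsArchSmooth incl (lieDeriv incl (toLie e₁₁) F) := isArchSmooth_lieDeriv_toLie hs e₁₁
  have heq : (fun w : ℂ => fderiv ℝ (fun z : ℂ => F (upperHalfPlaneToGL (ofComplex z))) w Complex.I) =ᶠ[𝓝 (τ : ℂ)]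
      fun w : ℂ => (w.im)⁻¹ • lieDeriv incl (toLie e₁₁) F (upperHalfPlaneToGL (ofComplex w)) := by
    filter_upwards [isOpen_upperHalfPlaneSet.mem_nhds τ.im_pos] with w hw
    have h := fderiv_comp_upperHalfPlaneToGL_I hs ⟨w, hw⟩
    rw [ofComplex_apply_of_im_pos hw]
    exact h
  rw [heq.fderiv_eq, (hasFDerivAt_im_inv_smul_comp hB τ).fderiv]
  simp only [FunLike.coe_smul, FunLike.coe_add, Pi.smul_apply, Pi.add_apply,
    ContinuousLinearMap.smulRight_apply,
    Complex.imCLM_apply, Complex.reCLM_apply, Complex.I_im, Complex.I_re, zero_smul, one_smul, add_zero,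
    smul_smul, smul_eq_mul, mul_one]

/-- **The hyperbolic Laplacian of `u(τ) = F(g_τ)` is `(E₁₁² + E₁₂² - E₁₁) F` at `g_τ`** (Iwaniec's
`Δ = y²(∂ₓ² + ∂_y²)`; `E₁₂ = y ∂ₓ`, `E₁₁ = y ∂_y` on the section). [cite: Bump1997, §2.2]
[cite: Iwaniec2002, (1.19)] -/
theorem hypLaplacian_comp_upperHalfPlaneToGL_eq (hs : IsArchSmooth incl F) (τ : ℍ) :
    hypLaplacian (fun τ : ℍ => F (upperHalfPlaneToGL τ)) τ =
      lieDeriv incl (toLie e₁₁) (lieDeriv incl (toLie e₁₁) F) (upperHalfPlaneToGL τ) +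
        lieDeriv incl (toLie e₁₂) (lieDeriv incl (toLie e₁₂) F) (upperHalfPlaneToGL τ) -
        lieDeriv incl (toLie e₁₁) F (upperHalfPlaneToGL τ) := by
  rw [hypLaplacian_eq_fderiv_fderiv (isC2_comp_upperHalfPlaneToGL hs) τ]
  change ((τ.im : ℝ) : ℂ) ^ 2 *
      (fderiv ℝ (fun w : ℂ => fderiv ℝ (fun z : ℂ => F (upperHalfPlaneToGL (ofComplex z))) w 1) (τ : ℂ) 1 +
        fderiv ℝ (fun w : ℂ => fderiv ℝ (fun z : ℂ => F (upperHalfPlaneToGL (ofComplex z))) w Complex.I) (τ : ℂ)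
          Complex.I) = _
  rw [fderiv_fderiv_comp_upperHalfPlaneToGL_one hs τ, fderiv_fderiv_comp_upperHalfPlaneToGL_I hs τ]
  simp only [Complex.real_smul]
  have hy : ((τ.im : ℝ) : ℂ) ≠ 0 := by exact_mod_cast τ.im_ne_zero
  push_cast
  field_simp
  ring

end Analysis

/-! ### The eigen-equation of the descent -/

section Eigen

variable {G : Type*} [Group G] {j : GL (Fin 2) ℝ →* G}

/-- Iterated Lie derivatives along `j` at `a · j(x)` are iterated Lie derivatives on `GL₂(ℝ)` of the
pull-back. [folklore] -/
theorem lieDeriv_lieDeriv_inclOf_apply (ψ : G → ℂ) (a : G) (X Y : Matrix (Fin 2) (Fin 2) ℝ) (x : GL (Fin 2) ℝ) :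
    lieDeriv (inclOf j) (toLie X) (lieDeriv (inclOf j) (toLie Y) ψ) (a * j x) =
      lieDeriv incl (toLie X) (lieDeriv incl (toLie Y) fun y => ψ (a * j y)) x := by
  rw [lieDeriv_inclOf_apply]
  congr 1
  funext y
  exact lieDeriv_inclOf_apply ψ a Y y

/-- **The Laplace eigen-equation of the weight-`0` descent**: if `φ₀` on `GL₂(𝔸_ℚ)` is
archimedean-smooth along `ι_𝔸`, of `SO(2)`-weight `0`, killed by `Z`, with `Ω φ₀ = c φ₀`, then
`u(τ) = φ₀((g_τ, 1))` satisfies `Δ u + (-c/2) u = 0` for Iwaniec's `Δ = y²(∂ₓ² + ∂_y²)`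
(`Ω = 2(E₁₁² + E₁₂² - E₁₁) = 2Δ` on such functions). [cite: Bump1997, §2.2 (Prop. 2.2.5)]
[cite: Iwaniec2002, (1.19)–(1.22)] -/
theorem descent_eigen {φ₀ : (AdelicGroupData.gl 2 ℚ).Adelic → ℂ} (hs : IsArchSmooth Rat.iotaA φ₀)
    (hw : IsWeightVec Rat.iotaA 0 φ₀) (hZ : lieDeriv Rat.iotaA (toLie 1) φ₀ = 0) {c : ℝ}
    (hcas : casimirFun Rat.iotaA φ₀ = (c : ℂ) • φ₀) (τ : ℍ) :
    hypLaplacian (fun τ : ℍ => φ₀ (Rat.ofRealGLA (upperHalfPlaneToGL τ))) τ +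
      (((-c / 2 : ℝ)) : ℂ) * φ₀ (Rat.ofRealGLA (upperHalfPlaneToGL τ)) = 0 := by
  set F : GL (Fin 2) ℝ → ℂ := fun x => φ₀ (1 * Rat.ofRealGLA x) with hF_def
  have hF : IsArchSmooth incl F := isArchSmooth_incl_of_inclOf hs 1
  have hu : (fun τ : ℍ => φ₀ (Rat.ofRealGLA (upperHalfPlaneToGL τ))) = fun τ => F (upperHalfPlaneToGL τ) := by
    funext τ'; simp only [hF_def, one_mul]
  have hu' : φ₀ (Rat.ofRealGLA (upperHalfPlaneToGL τ)) = F (upperHalfPlaneToGL τ) := by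
    simp only [hF_def, one_mul]
  -- the Casimir identity at `(g_τ, 1)`
  have hA := congrFun (casimirFun_eq_of_isWeightVec_zero hs hw hZ) (1 * Rat.ofRealGLA (upperHalfPlaneToGL τ))
  rw [hcas] at hA
  simp only [Pi.smul_apply, Pi.add_apply, Pi.sub_apply, smul_eq_mul] at hA
  rw [lieDeriv_lieDeriv_inclOf_apply, lieDeriv_lieDeriv_inclOf_apply, lieDeriv_inclOf_apply] at hA
  -- the Laplacian on the section
  rw [hu, hu', hypLaplacian_comp_upperHalfPlaneToGL_eq hF τ]
  change _ + (((-c / 2 : ℝ)) : ℂ) * F (upperHalfPlaneToGL τ) = 0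
  push_cast
  linear_combination (-(1 : ℂ) / 2) * hA

/-- **Registered sub-goal `stub_descent_eigen` of `stub_descent`** (closed form of `descent_eigen`):
the Casimir eigenvalue `c` of a weight-`0`, `Z`-killed vector descends to the Laplace eigenvalue
`-c/2` of `u(τ) = φ₀((g_τ, 1))`. [cite: Bump1997, §2.2 (Prop. 2.2.5)] -/
theorem stub_descent_eigen : ∀ (φ₀ : (AdelicGroupData.gl 2 ℚ).Adelic → ℂ) (c : ℝ), IsArchSmooth Rat.iotaA φ₀ → IsWeightVec Rat.iotaA 0 φ₀ → lieDeriv Rat.iotaA (toLie 1) φ₀ = 0 → casimirFun Rat.iotaA φ₀ = (c : ℂ) • φ₀ → ∀ τ : UpperHalfPlane, hypLaplacian (fun τ : UpperHalfPlane => φ₀ (Rat.ofRealGLA (upperHalfPlaneToGL τ))) τ + (((-c / 2 : ℝ)) : ℂ) * φ₀ (Rat.ofRealGLA (upperHalfPlaneToGL τ)) = 0 :=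
  fun _ _ hs hw hZ hcas τ => descent_eigen hs hw hZ hcas τ

end Eigen

end Summit.Langlands.Langlands.Theorems.CorrespondentFingerprint
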